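import Summits.ABC.ABC.Theses.TwistAmplification
import Literature.NumberTheory.DiophantineGeometry.AbcShapeGeometrySets

/-!
# `ShapeLevelLift`: the `d = 2` level-torsor bound lifts to every dimension (stmt-ABC-2757)

Stub `ShapeLevelLift` of line `peyre-level-torsor-v22` for the crux
`Summit.ABC.ABC.Theses.TwistAmplification.MazurKaneLaw`.  In the tree's shape language
(`AbcShapes.shapeCount`: solutions of `c₁ ∏ xᵢ^{i+1} + c₂ ∏ yᵢ^{i+1} = c₃ ∏ zᵢ^{i+1}` in dyadic
boxes with `gcd(c₁ ∏ xᵢ, c₂ ∏ yᵢ, c₃ ∏ zᵢ) = 1`), the hypothesis is the `d = 2` LEVER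
`B₂(f; X, Y, Z) ≤ K (f₃ Z₀Z₁²)^ε (1 + X₀X₁Y₀Y₁Z₀Z₁ / (f₃ Z₀Z₁²))` (uniformly in `f`), and the
conclusion is, for every `d ≥ 2`,
`B_d(c; X, Y, Z) ≤ K' (c₃ V(Z))^ε (∏_{i ≥ 2} XᵢYᵢZᵢ + ∏ᵢ XᵢYᵢZᵢ / (c₃ V(Z)))`, `V(Z) = ∏ Zᵢ^{i+1}`.

Proof (pattern of `AbcShapes.shapeCount_le_geometry_sets`): freeze the two LOW coordinates `0, 1`
(`S = {i : i < 2}`, written as the complement of the level filter `{i : 2 ≤ i}`) and fibre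
`shapeTriples c X Y Z` over `subBox S X ×ˢ subBox S Y ×ˢ subBox S Z`, i.e. over the level
coordinates `(xᵢ, yᵢ, zᵢ)_{i ≥ 2}`.  On the fibre over `(ox, oy, oz)` put `fⱼ = cⱼ · offVal S oⱼ`
(`offVal S x = ∏_{i ≥ 2} xᵢ^{i+1}`); restricting to the coordinates `0, 1` injects the fibre into
`shapeTriples f₁ f₂ f₃ X' Y' Z'` (`X' = (X₀, X₁)`; the outer `gcd = 1` gives the inner one since a
prime dividing `c₁ · offVal S x · x₀x₁` divides `c₁ ∏ xᵢ`).  The lever bounds the fibre by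
`K (f₃ V(Z'))^ε (1 + X₀X₁Y₀Y₁Z₀Z₁/(f₃ V(Z')))`, and `c₃ V(Z) ≤ f₃ V(Z') ≤ 2^{d²} c₃ V(Z)` on the
box; summing over the `∏_{i ≥ 2} XᵢYᵢZᵢ` fibres gives the claim with `K' = max K 0 · 2^{d² ε}`.
-/

namespace Summit.ABC.ABC.Theorems

open Finset
open Literature.NumberTheory.DiophantineGeometry
open Literature.NumberTheory.DiophantineGeometry.AbcShapes

/-! ### The two low coordinates -/

/-- Membership in the low set `S = {i : 2 ≤ i}ᶜ` is `i < 2`. [folklore] -/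
private theorem mem_lowSet {d : ℕ} {S : Finset (Fin d)}
    (hS : S = (univ.filter (fun i : Fin d => 2 ≤ (i : ℕ)))ᶜ) (i : Fin d) :
    i ∈ S ↔ (i : ℕ) < 2 := by
  rw [hS, mem_compl, mem_filter]
  simp

/-- The low set is the image of `Fin 2` under `Fin.castLE`. [folklore] -/
private theorem lowSet_eq_image {d : ℕ} (hd : 2 ≤ d) {S : Finset (Fin d)}
    (hS : S = (univ.filter (fun i : Fin d => 2 ≤ (i : ℕ)))ᶜ) :
    S = univ.image (Fin.castLE hd) := by
  ext i
  rw [mem_lowSet hS, mem_image]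
  constructor
  · intro hi
    exact ⟨⟨i, hi⟩, mem_univ _, Fin.ext rfl⟩
  · rintro ⟨j, -, rfl⟩
    exact j.isLt

/-- A product over the low set is a product over `Fin 2`. [folklore] -/
private theorem prod_lowSet {M : Type*} [CommMonoid M] {d : ℕ} (hd : 2 ≤ d)
    {S : Finset (Fin d)} (hS : S = (univ.filter (fun i : Fin d => 2 ≤ (i : ℕ)))ᶜ)
    (g : Fin d → M) : ∏ i ∈ S, g i = ∏ j : Fin 2, g (Fin.castLE hd j) := by
  rw [lowSet_eq_image hd hS, prod_image fun a _ b _ h => Fin.castLE_injective hd h]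

/-- `W_S(x) = ∏_{i < 2} xᵢ^{i+1}` is the `d = 2` shape value of the low part. [folklore] -/
private theorem onVal_lowSet {d : ℕ} (hd : 2 ≤ d) {S : Finset (Fin d)}
    (hS : S = (univ.filter (fun i : Fin d => 2 ≤ (i : ℕ)))ᶜ) (x : Fin d → ℕ) :
    onVal S x = shapeVal (x ∘ Fin.castLE hd) := by
  rw [onVal, prod_lowSet hd hS]
  rfl

/-- `∏_{i < 2} xᵢ` is the plain product of the low part. [folklore] -/
private theorem prod_lowSet_eq_shapeProd {d : ℕ} (hd : 2 ≤ d) {S : Finset (Fin d)}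
    (hS : S = (univ.filter (fun i : Fin d => 2 ≤ (i : ℕ)))ᶜ) (x : Fin d → ℕ) :
    ∏ i ∈ S, x i = shapeProd (x ∘ Fin.castLE hd) := by
  rw [prod_lowSet hd hS]
  rfl

/-- The plain product of the low part divides `∏ᵢ xᵢ`. [folklore] -/
private theorem shapeProd_comp_dvd {d : ℕ} (hd : 2 ≤ d) {S : Finset (Fin d)}
    (hS : S = (univ.filter (fun i : Fin d => 2 ≤ (i : ℕ)))ᶜ) (x : Fin d → ℕ) :
    shapeProd (x ∘ Fin.castLE hd) ∣ shapeProd x := by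
  rw [← prod_lowSet_eq_shapeProd hd hS]
  exact prod_dvd_prod_of_subset _ _ _ (subset_univ _)

/-- `∏_{i < 2} XᵢYᵢZᵢ = X₀X₁Y₀Y₁Z₀Z₁` (real form). [folklore] -/
private theorem prod_lowSet_real {d : ℕ} (hd : 2 ≤ d) {S : Finset (Fin d)}
    (hS : S = (univ.filter (fun i : Fin d => 2 ≤ (i : ℕ)))ᶜ) (X Y Z : Fin d → ℕ) :
    ∏ i ∈ S, ((X i : ℝ) * Y i * Z i) =
      ((X ∘ Fin.castLE hd) 0 : ℝ) * (X ∘ Fin.castLE hd) 1 * (Y ∘ Fin.castLE hd) 0 *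
        (Y ∘ Fin.castLE hd) 1 * (Z ∘ Fin.castLE hd) 0 * (Z ∘ Fin.castLE hd) 1 := by
  rw [prod_lowSet hd hS, Fin.prod_univ_two]
  simp only [Function.comp_apply]
  ring

/-- The low part of a box point lies in the low box. [folklore] -/
private theorem comp_mem_dyadicBox {d : ℕ} (hd : 2 ≤ d) {X x : Fin d → ℕ}
    (h : x ∈ dyadicBox X) : (x ∘ Fin.castLE hd) ∈ dyadicBox (X ∘ Fin.castLE hd) := by
  rw [mem_dyadicBox] at h ⊢
  exact fun j => h _

/-- A tuple is determined by its frozen-low version and its low part. [folklore] -/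
private theorem eq_of_freezeOn_eq_of_comp_eq {d : ℕ} (hd : 2 ≤ d) {S : Finset (Fin d)}
    (hS : S = (univ.filter (fun i : Fin d => 2 ≤ (i : ℕ)))ᶜ) {W x x' : Fin d → ℕ}
    (h1 : freezeOn S W x = freezeOn S W x')
    (h2 : (x ∘ Fin.castLE hd) = (x' ∘ Fin.castLE hd)) : x = x' := by
  funext i
  by_cases hi : (i : ℕ) < 2
  · have h := congrFun h2 ⟨i, hi⟩
    have hc : Fin.castLE hd ⟨i, hi⟩ = i := Fin.ext rfl
    simpa only [Function.comp_apply, hc] using h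
  · have hi' : i ∉ S := fun h => hi ((mem_lowSet hS i).mp h)
    have h := congrFun h1 i
    simpa only [freezeOn, hi', if_false] using h

/-! ### Arithmetic on a level fibre -/

/-- A prime dividing `c · offVal_S(x) · m` with `m ∣ ∏ᵢ xᵢ` divides `c ∏ᵢ xᵢ`. [folklore] -/
private theorem prime_dvd_transfer {d p c m : ℕ} (hp : p.Prime) (S : Finset (Fin d))
    {x : Fin d → ℕ} (hm : m ∣ shapeProd x) (h : p ∣ c * offVal S x * m) : p ∣ c * shapeProd x := by
  have h' : p ∣ c * shapeVal x * shapeProd x :=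
    h.trans (mul_dvd_mul (mul_dvd_mul_left c ⟨onVal S x, shapeVal_eq_offVal_mul_onVal S x⟩) hm)
  rcases (Nat.Prime.dvd_mul hp).mp h' with h1 | h1
  · exact prime_dvd_mul_shapeProd hp h1
  · exact dvd_mul_of_dvd_right h1 _

/-- On the box, the level part `offVal_S(z)` is at most `2^{d²}` times its corner value.
[folklore] -/
private theorem offVal_le_pow_mul {d : ℕ} (S : Finset (Fin d)) {Z z : Fin d → ℕ}
    (hz : ∀ i, z i < 2 * Z i) : offVal S z ≤ 2 ^ (d * d) * offVal S Z := by
  calc offVal S z = ∏ i ∈ Sᶜ, z i ^ ((i : ℕ) + 1) := rfl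
    _ ≤ ∏ i ∈ Sᶜ, 2 ^ d * Z i ^ ((i : ℕ) + 1) :=
        prod_le_prod (fun _ _ => Nat.zero_le _) fun i _ => by
          calc z i ^ ((i : ℕ) + 1) ≤ (2 * Z i) ^ ((i : ℕ) + 1) :=
                Nat.pow_le_pow_left (hz i).le _
            _ = 2 ^ ((i : ℕ) + 1) * Z i ^ ((i : ℕ) + 1) := mul_pow _ _ _
            _ ≤ 2 ^ d * Z i ^ ((i : ℕ) + 1) :=
                Nat.mul_le_mul_right _ (Nat.pow_le_pow_right two_pos (Nat.succ_le_of_lt i.isLt))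
    _ = (2 ^ d) ^ (Sᶜ).card * offVal S Z := by rw [prod_mul_distrib, prod_const]; rfl
    _ ≤ (2 ^ d) ^ d * offVal S Z :=
        Nat.mul_le_mul_right _ (Nat.pow_le_pow_right (by positivity)
          ((card_le_univ _).trans_eq (Fintype.card_fin d)))
    _ = 2 ^ (d * d) * offVal S Z := by rw [← pow_mul]

/-- **The fibre injection.** The level fibre of `shapeTriples c X Y Z` over `(ox, oy, oz)` injects,
by restriction to the low coordinates, into the `d = 2` solution set with coefficients
`fⱼ = cⱼ · offVal_S(oⱼ)` and boxes `X' = (X₀, X₁)` etc. [folklore] -/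
private theorem card_levelFibre_le {d : ℕ} (hd : 2 ≤ d) {S : Finset (Fin d)}
    (hS : S = (univ.filter (fun i : Fin d => 2 ≤ (i : ℕ)))ᶜ) (c₁ c₂ c₃ : ℕ)
    (X Y Z ox oy oz : Fin d → ℕ) :
    ((shapeTriples c₁ c₂ c₃ X Y Z).filter (fun t =>
        (freezeOn S X t.1, freezeOn S Y t.2.1, freezeOn S Z t.2.2) = (ox, oy, oz))).card ≤
      shapeCount (c₁ * offVal S ox) (c₂ * offVal S oy) (c₃ * offVal S oz)
        (X ∘ Fin.castLE hd) (Y ∘ Fin.castLE hd) (Z ∘ Fin.castLE hd) := by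
  classical
  refine card_le_card_of_injOn
    (fun t => ((t.1 ∘ Fin.castLE hd), (t.2.1 ∘ Fin.castLE hd), (t.2.2 ∘ Fin.castLE hd)))
    (fun t ht => ?_) (fun t ht t' ht' h => ?_)
  · obtain ⟨htF, hφt⟩ := mem_filter.mp (mem_coe.mp ht)
    obtain ⟨hbox, heq, hg⟩ := mem_filter.mp htF
    simp only [mem_product] at hbox
    obtain ⟨hbx, hby, hbz⟩ := hbox
    simp only [Prod.mk.injEq] at hφt
    obtain ⟨h1, h2, h3⟩ := hφt
    refine mem_coe.mpr (mem_filter.mpr ⟨?_, ?_, ?_⟩)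
    · simp only [mem_product]
      exact ⟨comp_mem_dyadicBox hd hbx, comp_mem_dyadicBox hd hby,
        comp_mem_dyadicBox hd hbz⟩
    · rw [shapeVal_eq_offVal_mul_onVal S t.1, shapeVal_eq_offVal_mul_onVal S t.2.1,
        shapeVal_eq_offVal_mul_onVal S t.2.2, ← offVal_freezeOn S X t.1,
        ← offVal_freezeOn S Y t.2.1, ← offVal_freezeOn S Z t.2.2, h1, h2, h3,
        onVal_lowSet hd hS, onVal_lowSet hd hS,
        onVal_lowSet hd hS] at heq
      dsimp only
      calc c₁ * offVal S ox * shapeVal (t.1 ∘ Fin.castLE hd) +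
            c₂ * offVal S oy * shapeVal (t.2.1 ∘ Fin.castLE hd)
          = c₁ * (offVal S ox * shapeVal (t.1 ∘ Fin.castLE hd)) +
              c₂ * (offVal S oy * shapeVal (t.2.1 ∘ Fin.castLE hd)) := by ring
        _ = c₃ * (offVal S oz * shapeVal (t.2.2 ∘ Fin.castLE hd)) := heq
        _ = c₃ * offVal S oz * shapeVal (t.2.2 ∘ Fin.castLE hd) := by ring
    · dsimp only
      rw [← h1, ← h2, ← h3, offVal_freezeOn, offVal_freezeOn, offVal_freezeOn]
      refine Nat.eq_one_iff_not_exists_prime_dvd.mpr fun p hp hdvd => ?_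
      have key : p ∣ Nat.gcd (c₁ * shapeProd t.1)
          (Nat.gcd (c₂ * shapeProd t.2.1) (c₃ * shapeProd t.2.2)) :=
        Nat.dvd_gcd
          (prime_dvd_transfer hp S (shapeProd_comp_dvd hd hS t.1)
            (hdvd.trans (Nat.gcd_dvd_left _ _)))
          (Nat.dvd_gcd
            (prime_dvd_transfer hp S (shapeProd_comp_dvd hd hS t.2.1)
              ((hdvd.trans (Nat.gcd_dvd_right _ _)).trans (Nat.gcd_dvd_left _ _)))
            (prime_dvd_transfer hp S (shapeProd_comp_dvd hd hS t.2.2)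
              ((hdvd.trans (Nat.gcd_dvd_right _ _)).trans (Nat.gcd_dvd_right _ _))))
      rw [hg] at key
      exact hp.one_lt.ne' (Nat.dvd_one.mp key)
  · obtain ⟨-, hφt⟩ := mem_filter.mp (mem_coe.mp ht)
    obtain ⟨-, hφt'⟩ := mem_filter.mp (mem_coe.mp ht')
    have hh := hφt.trans hφt'.symm
    simp only [Prod.mk.injEq] at hh h
    exact Prod.ext (eq_of_freezeOn_eq_of_comp_eq hd hS hh.1 h.1)
      (Prod.ext (eq_of_freezeOn_eq_of_comp_eq hd hS hh.2.1 h.2.1)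
        (eq_of_freezeOn_eq_of_comp_eq hd hS hh.2.2 h.2.2))

/-! ### The lift -/

/-- **Stub `ShapeLevelLift`** (line `peyre-level-torsor-v22`, crux stmt-ABC-2757): the `d = 2`
level-torsor bound `B₂(f; X, Y, Z) ≤ K (f₃ V(Z))^ε (1 + X₀X₁Y₀Y₁Z₀Z₁/(f₃ V(Z)))`, uniform in the
coefficients `f`, implies for every `d ≥ 2` the shape-level bound
`B_d(c; X, Y, Z) ≤ K' (c₃ V(Z))^ε (∏_{i ≥ 2} XᵢYᵢZᵢ + ∏ᵢ XᵢYᵢZᵢ/(c₃ V(Z)))`, by fibring over the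
level coordinates `i ≥ 2` (pattern of `AbcShapes.shapeCount_le_geometry_sets`; here
`K' = max K 0 · 2^{d² ε}`). [folklore] -/
theorem ShapeLevelLift : (∀ ε : ℝ, 0 < ε → ∃ K : ℝ, ∀ (f₁ f₂ f₃ : ℕ) (X Y Z : Fin 2 → ℕ), 0 < f₁ → 0 < f₂ → 0 < f₃ → (∀ i, 0 < X i) → (∀ i, 0 < Y i) → (∀ i, 0 < Z i) → (Literature.NumberTheory.DiophantineGeometry.AbcShapes.shapeCount f₁ f₂ f₃ X Y Z : ℝ) ≤ K * ((f₃ : ℝ) * ((Literature.NumberTheory.DiophantineGeometry.AbcShapes.shapeVal Z : ℕ) : ℝ)) ^ ε * (1 + ((X 0 : ℝ) * X 1 * Y 0 * Y 1 * Z 0 * Z 1) / ((f₃ : ℝ) * ((Literature.NumberTheory.DiophantineGeometry.AbcShapes.shapeVal Z : ℕ) : ℝ)))) → (∀ ε : ℝ, 0 < ε → ∀ d : ℕ, 2 ≤ d → ∃ K : ℝ, ∀ (c₁ c₂ c₃ : ℕ) (X Y Z : Fin d → ℕ), 0 < c₁ → 0 < c₂ → 0 < c₃ → (∀ i, 0 <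 X i) → (∀ i, 0 < Y i) → (∀ i, 0 < Z i) → (Literature.NumberTheory.DiophantineGeometry.AbcShapes.shapeCount c₁ c₂ c₃ X Y Z : ℝ) ≤ K * ((c₃ : ℝ) * ((Literature.NumberTheory.DiophantineGeometry.AbcShapes.shapeVal Z : ℕ) : ℝ)) ^ ε * ((∏ i ∈ Finset.univ.filter (fun i : Fin d => 2 ≤ (i : ℕ)), ((X i : ℝ) * Y i * Z i)) + (∏ i, ((X i : ℝ) * Y i * Z i)) / ((c₃ : ℝ) * ((Literature.NumberTheory.DiophantineGeometry.AbcShapes.shapeVal Z : ℕ) : ℝ)))) := by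
  intro hH ε hε d hd
  obtain ⟨K, hK⟩ := hH ε hε
  refine ⟨max K 0 * ((2 : ℝ) ^ (d * d)) ^ ε, ?_⟩
  intro c₁ c₂ c₃ X Y Z hc₁ hc₂ hc₃ hX hY hZ
  classical
  obtain ⟨S, hS⟩ : ∃ S : Finset (Fin d), S = (univ.filter (fun i : Fin d => 2 ≤ (i : ℕ)))ᶜ :=
    ⟨_, rfl⟩
  have hSc : Sᶜ = univ.filter (fun i : Fin d => 2 ≤ (i : ℕ)) := by rw [hS, compl_compl]
  set F := shapeTriples c₁ c₂ c₃ X Y Z with hF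
  set O := subBox S X ×ˢ subBox S Y ×ˢ subBox S Z with hO
  set φ : (Fin d → ℕ) × (Fin d → ℕ) × (Fin d → ℕ) → (Fin d → ℕ) × (Fin d → ℕ) × (Fin d → ℕ) :=
    fun t => (freezeOn S X t.1, freezeOn S Y t.2.1, freezeOn S Z t.2.2) with hφ
  have hmaps : Set.MapsTo φ (F : Set _) (O : Set _) := by
    intro t ht
    obtain ⟨hbox, -⟩ := mem_filter.mp (mem_coe.mp ht)
    simp only [mem_product] at hbox
    exact mem_coe.mpr (mem_product.mpr ⟨freezeOn_mem_subBox S hbox.1,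
      mem_product.mpr ⟨freezeOn_mem_subBox S hbox.2.1, freezeOn_mem_subBox S hbox.2.2⟩⟩)
  -- the sizes
  have hVpos : 0 < shapeVal Z := shapeVal_pos hZ
  set M : ℝ := (c₃ : ℝ) * ((shapeVal Z : ℕ) : ℝ) with hM
  have hMpos : 0 < M := by rw [hM]; exact_mod_cast Nat.mul_pos hc₃ hVpos
  set P' : ℝ := ((X ∘ Fin.castLE hd) 0 : ℝ) * (X ∘ Fin.castLE hd) 1 *
    (Y ∘ Fin.castLE hd) 0 * (Y ∘ Fin.castLE hd) 1 * (Z ∘ Fin.castLE hd) 0 *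
    (Z ∘ Fin.castLE hd) 1 with hP'
  have hP'0 : 0 ≤ P' := by rw [hP']; positivity
  set Bnd : ℝ := max K 0 * ((2 : ℝ) ^ (d * d)) ^ ε * M ^ ε * (1 + P' / M) with hBnd
  /- the bound on one fibre -/
  have hfib : ∀ o ∈ O, ((F.filter (fun t => φ t = o)).card : ℝ) ≤ Bnd := by
    rintro ⟨ox, oy, oz⟩ ho
    simp only [hO, mem_product] at ho
    obtain ⟨hox, hoy, hoz⟩ := ho
    have hoxpos : ∀ i, 0 < ox i := fun i =>
      lt_of_lt_of_le (hX i) ((mem_dyadicBox.mp (subBox_subset hX hox)) i).1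
    have hoypos : ∀ i, 0 < oy i := fun i =>
      lt_of_lt_of_le (hY i) ((mem_dyadicBox.mp (subBox_subset hY hoy)) i).1
    have hozge : ∀ i, Z i ≤ oz i := fun i => ((mem_dyadicBox.mp (subBox_subset hZ hoz)) i).1
    have hozlt : ∀ i, oz i < 2 * Z i := fun i => ((mem_dyadicBox.mp (subBox_subset hZ hoz)) i).2
    have hozpos : ∀ i, 0 < oz i := fun i => lt_of_lt_of_le (hZ i) (hozge i)
    have hf₁ : 0 < c₁ * offVal S ox := Nat.mul_pos hc₁ (prod_pos fun i _ => pow_pos (hoxpos i) _)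
    have hf₂ : 0 < c₂ * offVal S oy := Nat.mul_pos hc₂ (prod_pos fun i _ => pow_pos (hoypos i) _)
    have hf₃ : 0 < c₃ * offVal S oz := Nat.mul_pos hc₃ (prod_pos fun i _ => pow_pos (hozpos i) _)
    -- `c₃ V(Z) ≤ f₃ V(Z') ≤ 2^{d²} c₃ V(Z)`
    have hoff₁ : offVal S Z ≤ offVal S oz :=
      prod_le_prod (fun _ _ => Nat.zero_le _) fun i _ => Nat.pow_le_pow_left (hozge i) _
    have hoff₂ : offVal S oz ≤ 2 ^ (d * d) * offVal S Z := offVal_le_pow_mul S hozlt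
    have hlow : c₃ * shapeVal Z ≤ c₃ * offVal S oz * shapeVal (Z ∘ Fin.castLE hd) := by
      rw [shapeVal_eq_offVal_mul_onVal S Z, ← onVal_lowSet hd hS Z, mul_assoc]
      exact Nat.mul_le_mul_left _ (Nat.mul_le_mul_right _ hoff₁)
    have hupp : c₃ * offVal S oz * shapeVal (Z ∘ Fin.castLE hd) ≤
        2 ^ (d * d) * (c₃ * shapeVal Z) := by
      rw [shapeVal_eq_offVal_mul_onVal S Z, ← onVal_lowSet hd hS Z]
      calc c₃ * offVal S oz * onVal S Z ≤ c₃ * (2 ^ (d * d) * offVal S Z) * onVal S Z := by gcongr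
        _ = 2 ^ (d * d) * (c₃ * (offVal S Z * onVal S Z)) := by ring
    set M' : ℝ := ((c₃ * offVal S oz : ℕ) : ℝ) * ((shapeVal (Z ∘ Fin.castLE hd) : ℕ) : ℝ)
      with hM'
    have hMM' : M ≤ M' := by rw [hM, hM']; exact_mod_cast hlow
    have hM'le : M' ≤ (2 : ℝ) ^ (d * d) * M := by rw [hM, hM']; exact_mod_cast hupp
    have hM'pos : 0 < M' := lt_of_lt_of_le hMpos hMM'
    have hlev := hK _ _ _ (X ∘ Fin.castLE hd) (Y ∘ Fin.castLE hd)
      (Z ∘ Fin.castLE hd) hf₁ hf₂ hf₃ (fun _ => hX _) (fun _ => hY _) (fun _ => hZ _)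
    calc (((F.filter (fun t => φ t = (ox, oy, oz))).card : ℕ) : ℝ)
        ≤ (shapeCount (c₁ * offVal S ox) (c₂ * offVal S oy) (c₃ * offVal S oz)
            (X ∘ Fin.castLE hd) (Y ∘ Fin.castLE hd) (Z ∘ Fin.castLE hd) : ℝ) := by
          exact_mod_cast card_levelFibre_le hd hS c₁ c₂ c₃ X Y Z ox oy oz
      _ ≤ K * M' ^ ε * (1 + P' / M') := by rw [hM', hP']; exact_mod_cast hlev
      _ ≤ max K 0 * M' ^ ε * (1 + P' / M') :=
          mul_le_mul_of_nonneg_right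
            (mul_le_mul_of_nonneg_right (le_max_left K 0) (Real.rpow_nonneg hM'pos.le ε))
            (add_nonneg zero_le_one (div_nonneg hP'0 hM'pos.le))
      _ ≤ max K 0 * ((2 : ℝ) ^ (d * d) * M) ^ ε * (1 + P' / M) :=
          mul_le_mul
            (mul_le_mul_of_nonneg_left (Real.rpow_le_rpow hM'pos.le hM'le hε.le) (le_max_right K 0))
            (add_le_add le_rfl (div_le_div_of_nonneg_left hP'0 hMpos hMM'))
            (add_nonneg zero_le_one (div_nonneg hP'0 hM'pos.le))
            (mul_nonneg (le_max_right K 0) (Real.rpow_nonneg (by positivity) ε))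
      _ = Bnd := by rw [hBnd, Real.mul_rpow (by positivity) hMpos.le]; ring
  /- summing over the fibres -/
  calc (shapeCount c₁ c₂ c₃ X Y Z : ℝ) = (F.card : ℝ) := rfl
    _ = ∑ o ∈ O, ((F.filter (fun t => φ t = o)).card : ℝ) := by
        rw [card_eq_sum_card_fiberwise hmaps]; push_cast; rfl
    _ ≤ ∑ o ∈ O, Bnd := sum_le_sum hfib
    _ = O.card * Bnd := by rw [sum_const, nsmul_eq_mul]
    _ = _ := by
        have hOc : (O.card : ℝ) =
            ∏ i ∈ univ.filter (fun i : Fin d => 2 ≤ (i : ℕ)), ((X i : ℝ) * Y i * Z i) := by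
          rw [hO, card_product, card_product, card_subBox, card_subBox, card_subBox, hSc]
          push_cast
          simp only [prod_mul_distrib]
          ring
        have hfull : ∏ i, ((X i : ℝ) * Y i * Z i) =
            (∏ i ∈ univ.filter (fun i : Fin d => 2 ≤ (i : ℕ)), ((X i : ℝ) * Y i * Z i)) * P' := by
          rw [← prod_mul_prod_compl (univ.filter (fun i : Fin d => 2 ≤ (i : ℕ))), ← hS, hP',
            prod_lowSet_real hd hS]
        rw [hOc, hfull, hBnd]
        ring

end Summit.ABC.ABC.Theorems
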